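import Literature.NumberTheory.EllipticCurves.PAdicTwoVariableLocalUnitsShiftedDiagonal
import HarnessLib

/-!
# The compositum isomorphisms `ψ_n : E·K_π^{n+1} ≅ K(𝔪v^{n+1})_{𝔓_n}` are continuous, and so is `β ↦ ψ_n(β_{n,n+b})` on families of
# relative norm-coherent units (Serre, *Local Fields* II §2; de Shalit II.1.10, III.1.1)

Topic `NumberTheory/EllipticCurves`; namespace `Literature.NumberTheory.EllipticCurves`.  The `K_v`-algebra isomorphism
`ψ_n = supLtFieldEquivAdicCompletion` (`RayClassFieldLocalTowerCompositum`) goes between two different valuation currencies: the SPECTRAL norm of the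
Lubin–Tate files on `E·K_π^{n+1} ⊆ K̄_v` and Mathlib's `ℤᵐ⁰`-valued `Valued.v` on the completion `K(𝔪v^{n+1})_{𝔓_n}`; the bridge
`RayClassFieldLocalTowerCompositumNorm` records `‖y‖ < 1 ⟺ v_{𝔓_n}(ψ_n y) < 1` (and `≤ 1`, `= 1`).  THIS file draws the topological consequence:

* §1 `RingHom.continuous_of_norm_lt_one` — a ring homomorphism of normed fields `f : A → B` (`A` nontrivially normed) with `‖z‖ < 1 ⇒ ‖f z‖ < 1` is
  continuous: for `0 < ‖a‖ < 1` and `‖y‖ < ‖a‖^k`, `‖f y‖ < ‖f a‖^k → 0` (multiplicativity; an `ε`–`δ` argument at `0`).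
* §2 ★★ `continuous_supLtFieldEquivAdicCompletion` — `ψ_n` is continuous (the valued topology of the completion is the topology of
  `Valued.toNormedField`, `‖·‖ < 1 ⟺ v < 1`); ★★ `continuous_shiftDiagToAdicCompletion` — `β ↦ ψ_n(β_{n,n+b}) ∈ (F_n)_{𝔓_n}` is continuous on
  `∀ i, RelNormCoherentUnits hπ (E i)` (product topology; `RelNormCoherentUnits.continuous_val_apply`).

Use (cell `bsd-print-cf2`, brick §4(c), item «D4χ» `Summit…BrickCD4Chi.BrickCD4ChiClosureComparison`): the closedness `hBc` of the Shapiro image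
`B_χ = {β ∈ U¹_∞ | ∀ n, ψ_n(β_{n+r+1,n+ν}) ∈ I_n}` is `IsClosed U¹_∞ ∧ ∀ n, IsClosed (Φ_n ⁻¹' I_n)` with `Φ_n` the map of §2 — continuity of `Φ_n` is
the half supplied here (closedness of `I_n` is the compactness of Rubin's `𝒞̄(S_n)` read in `∏_w 𝒪_w`).
Theorems only; no named fact, no instance (the normed structure on the completion is a `letI` inside proofs), no `sorry`.

## References
* [SerreLocalFields1979] J.-P. Serre, *Local Fields*, GTM 67 (1979), Ch. II §1–§2 (the topology of a discretely valued field; Cor. 4).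
* [CasselsFrohlichANT1967] J. W. S. Cassels, A. Fröhlich (eds.), *Algebraic Number Theory* (1967), Ch. II §10 (`L ⊗ K_v ≅ ∏ L_w`, `L_w = K_v L`).
* [deShalit1987] E. de Shalit, *Iwasawa theory of elliptic curves with complex multiplication* (1987), II.1.10 (p. 39), III.1.1 (p. 88).
-/

noncomputable section

open NumberField IsDedekindDomain IsDedekindDomain.HeightOneSpectrum Field
open scoped nonZeroDivisors Classical

namespace Literature.NumberTheory.EllipticCurves

open Literature.NumberTheory.GaloisRepresentations
open Literature.NumberTheory.GaloisRepresentations.ArtinLocalGlobal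
open Literature.NumberTheory.GaloisRepresentations.IsNonarchimedeanLocalField
open Literature.NumberTheory.GaloisRepresentations.LubinTate
open Literature.NumberTheory.NumberFields
open Literature.NumberTheory.Automorphic
open ValuativeRel

/-! ### §1. A ring homomorphism of normed fields carrying the open unit ball into the open unit ball is continuous -/

/-- A ring homomorphism `f : A → B` of normed fields, `A` nontrivially normed, with `‖z‖ < 1 ⇒ ‖f z‖ < 1` is continuous: for `0 < ‖a‖ < 1` and
`‖y‖ < ‖a‖^k` one has `‖a^{-k} y‖ < 1`, hence `‖f y‖ < ‖f a‖^k`, and `‖f a‖^k → 0`. [cite: SerreLocalFields1979, Ch. II §1] -/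
theorem _root_.RingHom.continuous_of_norm_lt_one {A B : Type*} [NontriviallyNormedField A] [NormedField B] (f : A →+* B)
    (h : ∀ z : A, ‖z‖ < 1 → ‖f z‖ < 1) : Continuous f := by
  obtain ⟨a, ha0, ha1⟩ := NormedField.exists_norm_lt_one A
  have hfa1 : ‖f a‖ < 1 := h a ha1
  have hfa0 : 0 < ‖f a‖ := norm_pos_iff.mpr ((map_ne_zero f).mpr (norm_pos_iff.mp ha0))
  refine continuous_of_continuousAt_zero f ?_
  rw [ContinuousAt, map_zero, NormedAddCommGroup.tendsto_nhds_nhds]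
  intro ε hε
  obtain ⟨k, hk⟩ := exists_pow_lt_of_lt_one hε hfa1
  refine ⟨‖a‖ ^ k, pow_pos ha0 k, fun y hy ↦ ?_⟩
  rw [sub_zero] at hy ⊢
  have h1 : ‖(a ^ k)⁻¹ * y‖ < 1 := by
    rw [norm_mul, norm_inv, norm_pow, inv_mul_lt_iff₀ (pow_pos ha0 k), mul_one]
    exact hy
  have h2 := h _ h1
  rw [map_mul, map_inv₀, map_pow, norm_mul, norm_inv, norm_pow, inv_mul_lt_iff₀ (pow_pos hfa0 k), mul_one] at h2
  exact h2.trans hk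

/-! ### §2. `ψ_n` and `β ↦ ψ_n(β_{n,n+b})` are continuous -/

attribute [local instance] ltNormUniformSpace ltNormIsUniformAddGroup rk1 nF nE fintypeResidueField

section Level

variable {K : Type} [Field K] [NumberField K] [IsTotallyComplex K] {v : HeightOneSpectrum (𝓞 K)}
  {π : 𝒪[v.adicCompletion K]} (hπ : (valuation (v.adicCompletion K)).IsUniformizer (π : v.adicCompletion K))
  {𝔪 : Ideal (𝓞 K)} (h𝔪 : 𝔪 ≠ ⊥) (hv : ¬ 𝔪 ≤ v.asIdeal) (hw : ∀ u : (𝓞 K)ˣ, (u : 𝓞 K) - 1 ∈ 𝔪 → u = 1)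
  {α : 𝓞 K} (hα0 : α ≠ 0) (hα𝔪 : α - 1 ∈ 𝔪) (hαw : ∀ w : HeightOneSpectrum (𝓞 K), w ≠ v → α ∉ w.asIdeal)
  {f : ℕ} (hαπ : ((α : K) : v.adicCompletion K) = (π : v.adicCompletion K) ^ f)
  (E : IntermediateField (v.adicCompletion K) (AlgebraicClosure (v.adicCompletion K)))
  [FiniteDimensional (v.adicCompletion K) E] [Normal (v.adicCompletion K) E] (hE : E ≤ maxUnramified (v.adicCompletion K))
  (hdegE : ∀ w : WeilGroup (v.adicCompletion K),
    WeilGroup.toAbsGalois (v.adicCompletion K) w ∈ E.fixingSubgroup → (f : ℤ) ∣ WeilGroup.deg w)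
  (hdvd : ((Module.finrank (v.adicCompletion K) E : ℕ) : ℤ) ∣
    (orderOf (abRestrict (rayClassField K 𝔪)
      (ideleArtinMap K (localUnits v (Units.mk0 (π : v.adicCompletion K) hπ.ne_zero)))) : ℤ))

/-- ★★ **`ψ_n : E·K_π^{n+1} ≅ K(𝔪v^{n+1})_{𝔓_n}` is continuous** (spectral-norm topology to the `𝔓_n`-adic topology): `‖y‖ < 1 ⟺ v_{𝔓_n}(ψ_n y) < 1`
(`norm_lt_one_iff_valued_supLtFieldEquiv_lt_one`) and §1, the valued topology being that of `Valued.toNormedField`.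
[cite: SerreLocalFields1979, Ch. II §2 Cor. 4] [cite: CasselsFrohlichANT1967, Ch. II §10] [cite: deShalit1987, II.1.10 (p. 39)] -/
theorem continuous_supLtFieldEquivAdicCompletion (n : ℕ) :
    Continuous (supLtFieldEquivAdicCompletion h𝔪 hv hw hπ hα0 hα𝔪 hαw hαπ E hE hdegE hdvd n) := by
  letI : NormedField
      (((SemiLocal.embPlace v (rayClassField K (𝔪 * v.asIdeal ^ (n + 1))).val : SemiLocal.Place K (rayClassField K (𝔪 * v.asIdeal ^ (n + 1))) v) :
        HeightOneSpectrum (𝓞 (rayClassField K (𝔪 * v.asIdeal ^ (n + 1))))).adicCompletion (rayClassField K (𝔪 * v.asIdeal ^ (n + 1)))) :=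
    Valued.toNormedField _ (WithZero (Multiplicative ℤ))
  refine RingHom.continuous_of_norm_lt_one
    (supLtFieldEquivAdicCompletion h𝔪 hv hw hπ hα0 hα𝔪 hαw hαπ E hE hdegE hdvd n).toRingEquiv.toRingHom fun z hz ↦ ?_
  show ‖supLtFieldEquivAdicCompletion h𝔪 hv hw hπ hα0 hα𝔪 hαw hαπ E hE hdegE hdvd n z‖ < 1
  rw [Valued.toNormedField.norm_lt_one_iff]
  exact (norm_lt_one_iff_valued_supLtFieldEquiv_lt_one hπ h𝔪 hv hw hα0 hα𝔪 hαw hαπ E hE hdegE hdvd n z).mp hz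

end Level

section Families

variable {K : Type} [Field K] [NumberField K] [IsTotallyComplex K] {v : HeightOneSpectrum (𝓞 K)}
  {π : 𝒪[v.adicCompletion K]} (hπ : (valuation (v.adicCompletion K)).IsUniformizer (π : v.adicCompletion K))
  {𝔪 : ℕ → Ideal (𝓞 K)} (h𝔪0 : ∀ i, 𝔪 i ≠ ⊥) (hv : ∀ i, ¬ 𝔪 i ≤ v.asIdeal)
  (hw : ∀ i, ∀ u : (𝓞 K)ˣ, (u : 𝓞 K) - 1 ∈ 𝔪 i → u = 1)
  {α : ℕ → 𝓞 K} (hα0 : ∀ i, α i ≠ 0) (hα𝔪 : ∀ i, α i - 1 ∈ 𝔪 i) (hαw : ∀ i, ∀ w : HeightOneSpectrum (𝓞 K), w ≠ v → α i ∉ w.asIdeal)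
  {f : ℕ → ℕ} (hαπ : ∀ i, ((α i : K) : v.adicCompletion K) = (π : v.adicCompletion K) ^ f i)
  (E : ℕ → IntermediateField (v.adicCompletion K) (AlgebraicClosure (v.adicCompletion K)))
  [∀ i, FiniteDimensional (v.adicCompletion K) (E i)] [∀ i, IsGalois (v.adicCompletion K) (E i)]
  (hE : ∀ i, E i ≤ maxUnramified (v.adicCompletion K))
  (hdegE : ∀ i, ∀ w : WeilGroup (v.adicCompletion K),
    WeilGroup.toAbsGalois (v.adicCompletion K) w ∈ (E i).fixingSubgroup → (f i : ℤ) ∣ WeilGroup.deg w)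
  (hdvd : ∀ i, ((Module.finrank (v.adicCompletion K) (E i) : ℕ) : ℤ) ∣
    (orderOf (abRestrict (rayClassField K (𝔪 i))
      (ideleArtinMap K (localUnits v (Units.mk0 (π : v.adicCompletion K) hπ.ne_zero)))) : ℤ))
  (b : ℕ)

/-- ★★ **`β ↦ ψ_n(β_{n,n+b}) ∈ (F_n)_{𝔓_n}` is continuous** on the families `∀ i, RelNormCoherentUnits hπ (E i)` (product topology): evaluation at `i = n`,
the component `β_n ↦ β_{n,n+b}` (`RelNormCoherentUnits.continuous_val_apply`), the inclusion of the unit ball and `ψ_n` (`continuous_supLtFieldEquivAdicCompletion`).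
[cite: deShalit1987, III.1.1 (p. 88)] [cite: SerreLocalFields1979, Ch. II §2 Cor. 4] -/
theorem continuous_shiftDiagToAdicCompletion (n : ℕ) :
    Continuous fun β : ∀ i, RelNormCoherentUnits hπ (E i) ↦ shiftDiagToAdicCompletion hπ h𝔪0 hv hw hα0 hα𝔪 hαw hαπ E hE hdegE hdvd b β n :=
  (continuous_supLtFieldEquivAdicCompletion hπ (h𝔪0 n) (hv n) (hw n) (hα0 n) (hα𝔪 n) (hαw n) (hαπ n) (E n) (hE n) (hdegE n) (hdvd n) (n + b)).comp
    (continuous_subtype_val.comp ((RelNormCoherentUnits.continuous_val_apply hπ (E n) (n + b)).comp (continuous_apply n)))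

end Families

end Literature.NumberTheory.EllipticCurves

end
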